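import Summits.AnomalousDissipation.AnomalousDissipation.Theses.QuarticLadder
import Summits.AnomalousDissipation.AnomalousDissipation.Theorems.UniformResolution.Negative.ResolutionCriterion
import Summits.AnomalousDissipation.AnomalousDissipation.Theorems.UniformResolution.Negative.FGTBound
import Summits.AnomalousDissipation.AnomalousDissipation.Theorems.MomentParityUniformResolutionStubClosure
import Summits.AnomalousDissipation.AnomalousDissipation.Theorems.MomentParityUniformResolutionStubCylOfPoly
import Summits.AnomalousDissipation.AnomalousDissipation.Theorems.MomentParityUniformResolutionStubWeightedH2

/-!
# Line `Sketch` (card A, `enstrophy-ui-localized-tail-budget`) for crux `UniformResolution`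
# (stmt-AnomalousDissipation-14330; route decls `QuarticLadder.UniformResolution` ≡ `MomentParity.UniformResolution`,
# defeq twin bodies) — the lead's skeleton (continuation c17, 2026-08-17)

Lead prover-line-stmt-AnomalousDissipation-14330-c17-0 (continuation of leads -0, -c2, -c3, -c5, -c7, -c13, -c14, -c15; skeleton
re-owned VERBATIM from c14/c15 (registered sha b0b6c4da…), stubs S3 `stub_weightedH2` (instance `Ψ(e,z) = -(1+z)⁻³/6` of the landed
`CylRow.exists_cylindricalTest` of the sibling crux's `MomentParityResolvedDissipationStubSmoothCylRow` + the landed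
`FGT.stub_fgtBound` of `MomentParityResolvedDissipationStubFgtBound`, constant uniform in `N` AND `R`) and S4 `stub_loudUI` (the
lead's bet; crux-equivalent by p89716; the crux is closed modulo LHEE via p137959 ∘ p90200, see PICKED.md). Source skeleton:
`Cruxes/UniformResolution/SketchIdeator1.lean` (ideator 1, `LineShapeA :=
MomentClosure → TailBudgetDichotomy → ResolutionIffUI → LoudUI → UniformResolution`).

## The line in one paragraph

At FIXED viscosity `ν = ν_j` the conclusion of the crux asks for ONE resolution schedule `κ` over a loud
family of level-`N` laws, `N` frequently, the law being changeable level by level. (1) CLOSURE: the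
`d`-wise loud families of the antecedent close in `d` on the compact level ball to loud laws that are
polynomially stationary at EVERY order (`stub_closure`, the tree's `momentClosure_proof` without the `κ`
clause), hence Galerkin-stationary in FMRT's cylindrical sense (`stub_cylOfPoly`, Weierstrass-`C¹` on the
coordinate image). (2) RESOLUTION ⟸ UNIFORM INTEGRABILITY: such laws annihilate the Foias–Guillopé–Temam
row `(1+‖∇P_N u‖²)⁻⁴⟨F(u), −ΔP_N u⟩`, which gives the `N`-uniform, radius-free weighted `H²` bound
`∫ |Au|²/(1+‖∇u‖²)⁴ dμ ≤ 4(‖f‖² + K(ν))/ν²` (`stub_weightedH2` = the standing disprover's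
`weightedH2Bound_four_of_fgt ∘ isFGTStationary_of_isGalerkinStationaryCyl`, Disproof.lean §FGT/§FGTBridge);
with UNIFORM INTEGRABILITY of the enstrophy over the family, the landed RESOLUTION CRITERION
`exists_isResolved_of_uniformlyIntegrable_of_weightedH2` (Negative/ResolutionCriterion.lean) produces `κ`.
(3) THE BET `stub_loudUI` (= card A's K2 / `LoudUI`, crux-equivalent given (1)–(2)): from the loud
invariant families extract, at every `j`, a sequence of laws with uniformly integrable enstrophy which is
`N`-frequently a loud invariant level-`N` law in one ball, with budgets `(E′, ε′)` uniform in `j`.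

## Stubs (4) and composition

* `stub_closure`    (S1) closure in `d` at fixed `(f, ν, N, E, ε, R)`, polynomial all-order output. LANDED p89032.
* `stub_cylOfPoly`  (S2) all-order polynomial rows ⇒ cylindrical rows (FMRT class) on the level ball. LANDED p87397.
* `stub_weightedH2` (S3) `WeightedH2Bound 4` for families of cylindrically Galerkin-stationary level laws in balls.
  LANDED p162942 (lead c17, wave 1): `CylRow.exists_cylindricalTest` instance `Ψ(e,z) = -(1+z)⁻³/6` + `FGT.stub_fgtBound`.
* `stub_loudUI`     (S4) THE BET (lead). Open-problem grade: N-uniform integrability of the enstrophy of loud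
  Galerkin-invariant laws at fixed `ν` ⟺ mean energy EQUALITY of the loud Vishik–Fursikov limit (FMRT IV (1.31)).
* `UniformResolution_of` : kernel-checked composition, no `sorry` of its own; concludes
  `MomentParity.UniformResolution` by name.

Vocabulary (all landed): `IsLevel / IsBandTest / polyGrad / IsPolyStationary`
(`Theorems/QuarticGate/Negative/LevelCeiling.lean`), `IsLoudFamilyAt / IsResolvedLoudFamilyAt / IsResolved /
uniformResolution_iff` (`Theorems/UniformResolution/Negative/Shape.lean`), `UniformlyIntegrableEnstrophy /
WeightedH2Bound / eLapNormSq` (`Theorems/UniformResolution/Negative/ResolutionCriterion.lean`). No local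
definitions: every stub is stated over landed vocabulary and inlined clause shapes, so each lands verbatim as a
`Theorems/MomentParityUniformResolution…` file.

Disproof.lean (cdisprove rev 6, 2756 lines, sorry-free) READ before publishing: no `_false_without_` theorem;
load-bearing table honoured — stationarity is used at degree ≥ 2 (S3's row is a `C¹` functional of the
degree-2 observables `‖∇P_N u‖²`, reached only AFTER the all-order closure S1: a 3- or 4-stationary family is
not claimed resolved), `0 < ε` kept (only to have `ε′ > 0`), `0 < ν_j` used by S3, `Tendsto ν → 0` unused
(passed to S4 verbatim), `E′, ε′` produced by S4 inside the same ball (never laminar states, §E). §H of the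
Disproof is exactly arrows (2) here; §F (steady sector resolved) is S4's calibration case "Dirac families".
-/

noncomputable section

-- `Summit.<Summit>.<Problem>` duplicate namespace is the tree's mandated layout for single-conjunct summits.
set_option linter.dupNamespace false

namespace Summit.AnomalousDissipation.AnomalousDissipation.Theorems.QuarticLadderUniformResolution

open MeasureTheory Filter Topology
open scoped ENNReal
open Literature.Analysis.FunctionSpaces Literature.Analysis.FluidPDE
open Summit.AnomalousDissipation.AnomalousDissipation.Theorems.QuarticGate.Negative
open Summit.AnomalousDissipation.AnomalousDissipation.Theorems.UniformResolution.Negative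

/-! ## S1 — closure in the moment order at fixed level (MomentClosure without the `κ` clause) -/

/-- **S1 `stub_closure`.** At fixed `(f, ν, N, E, ε, R)`: loud `d`-stationary level-`N` laws in the ball
`‖u‖ ≤ R` for every order `d` give ONE loud level-`N` law in the same ball that is polynomially stationary at
EVERY order (weak-* compactness on the compact level ball; every polynomial row, the energy and the band
enstrophy are continuous there — steps 1–3 of the tree's `momentClosure_proof`). -/
theorem stub_closure (f : UnitAddTorus (Fin 3) → EuclideanSpace ℝ (Fin 3)) (hf : Torus.IsSmooth f)
    (ν : ℝ) (N : ℕ) (E ε R : ℝ)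
    (hd : ∀ d : ℕ, ∃ μ : Measure (Torus.energySpace (Fin 3)), IsProbabilityMeasure μ ∧ (∀ᵐ u ∂μ, IsLevel N u) ∧
      (∀ᵐ u ∂μ, ‖u‖ ≤ R) ∧ IsPolyStationary ν f N d μ ∧
      Torus.ensembleEnergy μ ≤ E ∧ ε ≤ Torus.ensembleDissipation ν μ) :
    ∃ μ : Measure (Torus.energySpace (Fin 3)), IsProbabilityMeasure μ ∧ (∀ᵐ u ∂μ, IsLevel N u) ∧ (∀ᵐ u ∂μ, ‖u‖ ≤ R) ∧
      (∀ d : ℕ, IsPolyStationary ν f N d μ) ∧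
      Torus.ensembleEnergy μ ≤ E ∧ ε ≤ Torus.ensembleDissipation ν μ :=
  -- LANDED (wave 1, p89032): `Theorems/MomentParityUniformResolutionStubClosure.lean`
  Theorems.MomentParityUniformResolution.stub_closure f hf ν N E ε R hd

/-! ## S2 — all-order polynomial rows give FMRT's cylindrical rows on the level ball -/

/-- **S2 `stub_cylOfPoly`.** A probability law carried by level-`N` fields in a ball which is polynomially
stationary at every order annihilates the generator row of every compactly supported `C¹` cylindrical test
functional with level-`N` band fields (Galerkin invariance in FMRT's sense): Weierstrass approximation with
first derivatives on the compact coordinate image (`integral_nsGeneratorPairing_grad_eq_zero` in tree). -/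
theorem stub_cylOfPoly (f : UnitAddTorus (Fin 3) → EuclideanSpace ℝ (Fin 3)) (hf : Torus.IsSmooth f)
    (ν : ℝ) (N : ℕ) (R : ℝ) (μ : Measure (Torus.energySpace (Fin 3))) [IsProbabilityMeasure μ]
    (hlev : ∀ᵐ u ∂μ, IsLevel N u) (hR : ∀ᵐ u ∂μ, ‖u‖ ≤ R) (hst : ∀ d : ℕ, IsPolyStationary ν f N d μ) :
    ∀ Φ : Torus.CylindricalTest (Fin 3), (∀ i, IsBandTest N (Φ.g i)) →
      Integrable (fun u => Torus.nsGeneratorPairing ν f u (Φ.grad u)) μ ∧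
        ∫ u, Torus.nsGeneratorPairing ν f u (Φ.grad u) ∂μ = 0 :=
  -- LANDED (wave 1, p87397): `Theorems/MomentParityUniformResolutionStubCylOfPoly.lean`
  Theorems.MomentParityUniformResolution.stub_cylOfPoly f hf ν N R μ hlev hR hst

/-! ## S3 — the Foias–Guillopé–Temam weighted `H²` bound for Galerkin-stationary level laws -/

/-- **S3 `stub_weightedH2`.** For a smooth force and `ν > 0`, every family of probability laws each carried
by level-`N` fields in some ball (level and radius may vary over the family) and Galerkin-stationary at its
level in FMRT's cylindrical sense satisfies the uniform weighted `H²` bound with exponent `4`: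
`∫ |Au|²/(1+‖∇u‖²)⁴ dμ ≤ 4(‖f‖₂² + K(ν))/ν²` (one stationarity row, the `C¹` cylindrical functional
`−(1+‖∇P_N u‖²)⁻³/6`; pointwise absorption by a dyadic Agmon inequality at a state-adapted cut). This is
`weightedH2Bound_four_of_fgt ∘ isFGTStationary_of_isGalerkinStationaryCyl` of the standing disprover
(Disproof.lean §FGT, §FGTBridge; files `Negative/FGTBound.lean`, `Negative/FGTBridge.lean`). -/
theorem stub_weightedH2 (f : UnitAddTorus (Fin 3) → EuclideanSpace ℝ (Fin 3)) (hf : Torus.IsSmooth f)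
    (ν : ℝ) (hν : 0 < ν) (𝓕 : Set (Measure (Torus.energySpace (Fin 3))))
    (h𝓕 : ∀ μ ∈ 𝓕, IsProbabilityMeasure μ ∧ ∃ (N : ℕ) (R : ℝ), (∀ᵐ u ∂μ, IsLevel N u) ∧
      (∀ᵐ u ∂μ, ‖u‖ ≤ R) ∧ ∀ Φ : Torus.CylindricalTest (Fin 3), (∀ i, IsBandTest N (Φ.g i)) →
        Integrable (fun u => Torus.nsGeneratorPairing ν f u (Φ.grad u)) μ ∧
          ∫ u, Torus.nsGeneratorPairing ν f u (Φ.grad u) ∂μ = 0) :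
    WeightedH2Bound 4 𝓕 :=
  -- LANDED (lead c17 wave 1, p162942): `Theorems/MomentParityUniformResolutionStubWeightedH2.lean`
  Theorems.MomentParityUniformResolution.stub_weightedH2 f hf ν hν 𝓕 h𝓕

/-! ## S4 — THE BET: loud invariant families with uniformly integrable enstrophy -/

/-- **S4 `stub_loudUI` (card A's transfer `C⁺ = LoudUI`; the lead's stub).** From loud invariant level-`N`
families at every `j` (the antecedent of the crux after S1: polynomially stationary at every order, one ball
per `j`, budgets `(E, ε)`), extract budgets `(E′, ε′)`, `ε′ > 0`, uniform in `j`, and at every `j` a radius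
`R` and a SEQUENCE of laws `μs : ℕ → Measure H` whose enstrophy is UNIFORMLY INTEGRABLE and which, for
infinitely many `N`, is at index `N` a loud invariant level-`N` law in the ball of radius `R`. Equivalent to
the crux given S1–S3 (resolution ⇒ uniform integrability on level laws in a ball); it is the `N`-uniform
mean energy EQUALITY of loud Galerkin-limit stationary statistical solutions at fixed `ν` (FMRT IV (1.31)
is an inequality in 3-D) — open-problem grade. -/
theorem stub_loudUI (f : UnitAddTorus (Fin 3) → EuclideanSpace ℝ (Fin 3)) (hfs : Torus.IsSmooth f)
    (hfd : Torus.IsDivFree f) (hfz : Torus.HasZeroMean f) (ν : ℕ → ℝ) (E ε : ℝ)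
    (hν : ∀ j, 0 < ν j) (hν0 : Tendsto ν atTop (𝓝 0)) (hε : 0 < ε)
    (hloud : ∀ j : ℕ, ∃ R : ℝ, ∃ᶠ N in atTop, ∃ μ : Measure (Torus.energySpace (Fin 3)), IsProbabilityMeasure μ ∧
      (∀ᵐ u ∂μ, IsLevel N u) ∧ (∀ᵐ u ∂μ, ‖u‖ ≤ R) ∧ (∀ d : ℕ, IsPolyStationary (ν j) f N d μ) ∧
      Torus.ensembleEnergy μ ≤ E ∧ ε ≤ Torus.ensembleDissipation (ν j) μ) :
    ∃ E' ε' : ℝ, 0 < ε' ∧ ∀ j : ℕ, ∃ (R : ℝ) (μs : ℕ → Measure (Torus.energySpace (Fin 3))),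
      UniformlyIntegrableEnstrophy (Set.range μs) ∧
      ∃ᶠ N in atTop, IsProbabilityMeasure (μs N) ∧ (∀ᵐ u ∂(μs N), IsLevel N u) ∧
        (∀ᵐ u ∂(μs N), ‖u‖ ≤ R) ∧ (∀ d : ℕ, IsPolyStationary (ν j) f N d (μs N)) ∧
        Torus.ensembleEnergy (μs N) ≤ E' ∧ ε' ≤ Torus.ensembleDissipation (ν j) (μs N) := by
  sorry

/-! ## The composition (kernel-checked, no `sorry` of its own) -/

/-- Uniform integrability of the enstrophy passes to subfamilies. [folklore] -/
theorem uniformlyIntegrableEnstrophy_mono {𝓕 𝓖 : Set (Measure (Torus.energySpace (Fin 3)))} (h : 𝓖 ⊆ 𝓕)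
    (hUI : UniformlyIntegrableEnstrophy 𝓕) : UniformlyIntegrableEnstrophy 𝓖 := fun η hη => by
  obtain ⟨L, hL, hF⟩ := hUI η hη
  exact ⟨L, hL, fun μ hμ => hF μ (h hμ)⟩

/-- **`UniformResolution` from the four stubs.** Fix `f, ν, E, ε` and the antecedent. At each `j` and each
of its frequently-many levels, S1 closes the `d`-wise loud laws into a loud law stationary at every order;
S4 returns `j`-uniform budgets `(E′, ε′)` and, at each `j`, a ball and a uniformly integrable sequence `μs`
that is frequently a loud invariant level law; the subfamily `𝓕` of those members is uniformly integrable,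
Galerkin-stationary in the cylindrical sense by S2, hence carries the weighted `H²` bound by S3, and the landed
resolution criterion gives ONE schedule `κ` resolving all of `𝓕` — the conclusion body, with the SAME law
serving every order `d`. -/
theorem UniformResolution_of :
    Summit.AnomalousDissipation.AnomalousDissipation.Theses.QuarticLadder.UniformResolution := by
  intro f hfs hfd hfz ν E ε hν hν0 hε hhyp
  -- S1: close the d-wise loud families in d, level by level
  have hinv : ∀ j : ℕ, ∃ R : ℝ, ∃ᶠ N in atTop, ∃ μ : Measure (Torus.energySpace (Fin 3)), IsProbabilityMeasure μ ∧
      (∀ᵐ u ∂μ, IsLevel N u) ∧ (∀ᵐ u ∂μ, ‖u‖ ≤ R) ∧ (∀ d : ℕ, IsPolyStationary (ν j) f N d μ) ∧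
      Torus.ensembleEnergy μ ≤ E ∧ ε ≤ Torus.ensembleDissipation (ν j) μ := by
    intro j
    obtain ⟨R, hfreq⟩ := hhyp j
    exact ⟨R, hfreq.mono fun N hN => stub_closure f hfs (ν j) N E ε R hN⟩
  -- S4: the bet
  obtain ⟨E', ε', hε', hj⟩ := stub_loudUI f hfs hfd hfz ν E ε hν hν0 hε hinv
  refine ⟨E', ε', hε', fun j => ?_⟩
  obtain ⟨R, μs, hUI, hfreq⟩ := hj j
  -- the subfamily of invariant level laws in the ball among the `μs N`
  set 𝓕 : Set (Measure (Torus.energySpace (Fin 3))) := {μ | μ ∈ Set.range μs ∧ IsProbabilityMeasure μ ∧ ∃ N : ℕ,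
    (∀ᵐ u ∂μ, IsLevel N u) ∧ (∀ᵐ u ∂μ, ‖u‖ ≤ R) ∧ ∀ d : ℕ, IsPolyStationary (ν j) f N d μ} with h𝓕_def
  have hUI' : UniformlyIntegrableEnstrophy 𝓕 := uniformlyIntegrableEnstrophy_mono (fun μ hμ => hμ.1) hUI
  -- S2 + S3: the weighted H² bound over 𝓕
  have hH2 : WeightedH2Bound 4 𝓕 := by
    refine stub_weightedH2 f hfs (ν j) (hν j) 𝓕 fun μ hμ => ?_
    obtain ⟨-, hp, N, hl, hb, hst⟩ := hμ
    haveI := hp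
    exact ⟨hp, N, R, hl, hb, stub_cylOfPoly f hfs (ν j) N R μ hl hb hst⟩
  -- the landed resolution criterion
  obtain ⟨κ, hκ⟩ := exists_isResolved_of_uniformlyIntegrable_of_weightedH2 hUI' hH2
  refine ⟨R, κ, hfreq.mono ?_⟩
  rintro N ⟨hp, hl, hb, hst, hE, hD⟩ d
  have hmem : μs N ∈ 𝓕 := ⟨Set.mem_range_self N, hp, N, hl, hb, hst⟩
  exact ⟨μs N, hp, hl, hb, hκ (μs N) hmem, hst d, hE, hD⟩

/-- **The shared item's registered decl** (`MomentParity.UniformResolution`, the twin of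
`QuarticLadder.UniformResolution` with a definitionally equal body): the same composition. -/
theorem UniformResolution_proof :
    Summit.AnomalousDissipation.AnomalousDissipation.Theses.MomentParity.UniformResolution :=
  UniformResolution_of

end Summit.AnomalousDissipation.AnomalousDissipation.Theorems.QuarticLadderUniformResolution

end
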